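import Literature.NumberTheory.EllipticCurves.Sprung2024.ChromaticCharValueRankZero
import HarnessLib

/-!
# Sprung 2024, §5.2 Lemmas 5.5 · 5.8 · 5.9 for ALL conductors (the ♯/♭ `Γ`-Euler characteristic in
# analytic rank `0` without the square-free standing hypothesis), as attributed in print by
# Ray–Sprung 2025 — one named fact + its edge to the printed §5.2 form

Topic `Literature/NumberTheory/EllipticCurves`, cluster `Sprung2024`. Companion of
`Sprung2024/ChromaticCharValueRankZero.lean` (cell `bsd-ssimc`, seat kdot-split:
`lem59_sharpFlatCharValue_rankZero`, which carries §5.2's standing hypothesis "`E` has square-free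
conductor" as the binder `W.IsSemistable (𝓞 ℚ)`). ONE published statement vendored as a NAMED FACT
(`def … : Prop`, nothing asserted, no `_holds`; D-0014) plus one PROVED edge; net debt +1. Filed by
the LITERATURE-TYPING layer (D-0088(4), cell `bsd-littype`, seat `bsd-littype-11` g3) in answer to
the planner's want `W-KDOT-NSF` / D24-2 (114/142 rank-0 census cells at `(p, a_p) = (3, ±3)` have
non-square-free `N`). HONEST FRAMING: nothing about any curve is asserted; no census cell moves by
this file; BSD is not proved by any of this.

## What is printed, and where the conductor hypothesis sits

(1) F. Ito Sprung, Adv. Math. **449** (2024) 109741 [Sprung2024], §5.2 (pp. 39–41): Lemma 5.5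
"`1/|(Sel⋆(E,ℚ_∞))_Γ| = (∏_{l bad} c_l^{(p)} / #E(ℚ)_p) × 1/|ker g|`", Lemma 5.8
"`|Sel⋆(E,ℚ_∞)^Γ| = (|Sel(E,ℚ)| / #E(ℚ)_p) × |ker g|`", Lemma 5.9 "Let `f⋆` be a generator of the
characteristic ideal of `X⋆` and assume that `Sel⋆(E,ℚ_∞)^{Gal(ℚ_∞/ℚ)}` is finite. Then
`|f(0)|_p = |Sel⋆(E,ℚ_∞)^Γ| / |(Sel⋆(E,ℚ_∞))_Γ|`", multiplied as in "Proof of Theorem 5.3" (p. 41).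
The SECTION's standing hypotheses are those of Thm. 5.3 (p. 38): "square-free conductor `N`",
"supersingular reduction at `p ≠ 2`", "`L(E,1) ≠ 0`", "Conjecture 3.33". LINE CHECK (this seat,
pp. 38–41 of the version of record and §4.2, Lemmas 4.4–4.8 of the preprint arXiv:1610.10017): the
proofs of Remark 5.4 and Lemmas 5.5–5.9 invoke only [64] = [Sprung2012] Thm. 7.14, Lemma 2.3 and the
table before Prop. 6.14; Greenberg (LNM 1716) Lemmas 3.3, 4.2, 4.7 and [17] Lemma 4.3; Kobayashi
[Kobayashi2003] Prop. 9.2 / Thm. 9.3; Edixhoven [14, Thm. 2.6] (`E[p]` irreducible at a supersingular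
`p`); Kolyvagin [34] — none of which uses square-freeness; square-free `N` is used once, p. 38
l. 3–4, inside the proof of Thm. 5.1 (Ribet level-lowering ⇒ `E[p]` ramified at some `q ∥ N`), i.e.
for the main conjecture, not for the Euler characteristic.
(2) J. Ray and F. I. Sprung, Ann. Inst. Fourier **75** (2025) no. 6, 2341–2357 [RaySprung2025],
p. 2343, verbatim: "If one drops the assumption `a_v = 0`, the second author has generalized
Kobayashi's construction to construct a pair of chromatic Selmer groups `Sel♯` and `Sel♭` [25], and
given an analogous formula of Kim's [`∏ f^±(0) ∼ #Sel_p(E/F) · ∏_ℓ c_ℓ`], all assuming that `F = ℚ`,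
see [26, Lemmas 4.4, 4.5, 4.8]." ([25] = [Sprung2012]; [26] = arXiv:1610.10017, whose Lemmas 4.4,
4.5, 4.8 are Lemmas 5.8, 5.5, 5.9 of [Sprung2024].) This refereed sentence states the ♯/♭ formula
with the single assumption `F = ℚ` — no conductor condition. (Ray–Sprung's own Thm. 3.1, ibid.
pp. 2351–2352, proves the signed Euler-characteristic formula for every non-ordinary newform of level
`N` prime to `p`, again with no conductor condition, in the Lei–Loeffler–Zerbes signed-Selmer
language, which the tree does not have — `TODO(general form)`.)

FAITHFULNESS. `lem59AllN_sharpFlatCharValue_rankZero` below is `lem59_sharpFlatCharValue_rankZero`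
with the binder `W.IsSemistable (𝓞 ℚ)` removed and NOTHING else changed (same displayed hypotheses:
`p ≠ 2` good supersingular in the form `p ∣ a_p`, `L(E,1) ≠ 0`, the cyclotomic/Honda setting of
`Sprung2012.thm22_exists_isHondaSystem`, a dual datum `D` finitely generated and torsion over `Λ`, a
generator `f` of `char(X^⋆)`, `Sel_{p^∞}(E/ℚ)` finite; same conclusion
`f(0) = u · p^{ord_p ∏ c_l} · #Sel_{p^∞}(E/ℚ)`). It is STRONGER than the section-level statement of
[Sprung2024] and rests on (2) + the line check (1); flag `Sprung24-§5.2-allN-via-RaySprung25` for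
reviewers and consumers. The edge `lem59_sharpFlatCharValue_rankZero_of_allN` records that it
specialises to the printed §5.2 form.

References: [Sprung2024] §5.2, Lemmas 5.5, 5.8, 5.9 and Proof of Thm. 5.3 (pp. 39–41), Thm. 5.1
(p. 38); [RaySprung2025] p. 2343 (§1.2) and Thm. 3.1 (pp. 2351–2352); [Sprung2012] Thm. 7.14;
[Kobayashi2003] §9; B. D. Kim 2013 (the `±` twin, `BDKim2013/SignedCharValueRankZero.lean`).
-/

noncomputable section

open scoped Classical NumberField

open NumberField IsDedekindDomain WeierstrassCurve Literature.NumberTheory.EllipticCurves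
  Literature.NumberTheory.EllipticCurves.ZpExtension Literature.NumberTheory.EllipticCurves.Sprung2017
  Literature.NumberTheory.EllipticCurves.Sprung2012

namespace Literature.NumberTheory.EllipticCurves.Sprung2024

/-- **Sprung 2024 §5.2, Lemmas 5.5 · 5.8 · 5.9 multiplied, for every conductor — the ♯/♭ `Γ`-Euler
characteristic in analytic rank `0`, `f^⋆(0) ∼ #Sel_{p^∞}(E/ℚ) · ∏_l c_l^{(p)}` (with `#E(ℚ)_p = 1`),
as attributed by Ray–Sprung: "the second author has … construct[ed] a pair of chromatic Selmer groups
`Sel♯` and `Sel♭` [25], and given an analogous formula of Kim's, all assuming that `F = ℚ`, see [26,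
Lemmas 4.4, 4.5, 4.8]".** The body of `lem59_sharpFlatCharValue_rankZero` WITHOUT the binder
`W.IsSemistable (𝓞 ℚ)` (§5.2's standing "square-free conductor", used in print only for Thm. 5.1):
for `p ≠ 2` of good supersingular reduction (`p ∣ a_p`), `L(E,1) ≠ 0`, the setting of
`Sprung2012.thm22_exists_isHondaSystem`, either colour `⋆`, any dual datum `D` of `Sel^⋆(E/ℚ_∞)` that
is finitely generated torsion over `Λ`, any generator `f` of `char(X^⋆)` and `Sel_{p^∞}(E/ℚ)` finite:
`f(0) = u · p^{ord_p(∏_l c_l)} · #Sel_{p^∞}(E/ℚ)` for some `u ∈ ℤ_pˣ`. Flag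
`Sprung24-§5.2-allN-via-RaySprung25` (module docstring: stronger than the section-level statement of
[Sprung2024]; justified by the refereed attribution and the line check). Nothing is asserted; no
`_holds` is expected. [cite: RaySprung2025, p. 2343 (§1.2, the sentence on Sel♯/Sel♭ and [26, Lemmas 4.4, 4.5, 4.8])]
[cite: Sprung2024, §5.2 Lemmas 5.5, 5.8, 5.9 and Proof of Thm. 5.3 (pp. 40–41)] -/
def lem59AllN_sharpFlatCharValue_rankZero : Prop :=
  ∀ (W : WeierstrassCurve ℚ) [W.IsElliptic] [W.IsGloballyMinimal] (p : ℕ) [Fact p.Prime],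
    p ≠ 2 → W.HasGoodReductionAtPrime p → (p : ℤ) ∣ W.frobeniusTrace p →
    W.entireLFunction 1 ≠ 0 →
    ∀ (κ : ZpExtension ℚ p) (γ : Field.absoluteGaloisGroup ℚ),
      κ.IsCyclotomic → κ.IsTopGenerator γ → IsCyclotomicVariable p γ →
    ∀ (v : HeightOneSpectrum (𝓞 ℚ)), (p : 𝓞 ℚ) ∈ v.asIdeal →
    ∀ (g : Field.absoluteGaloisGroup (v.adicCompletion ℚ)),
      κ.IsTopGenerator (resGalOfEmb (closureEmb (K := ℚ) (v.adicCompletion ℚ)) g) →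
    ∀ (cneg : localPoints W (v.adicCompletion ℚ)) (c : ℕ → localPoints W (v.adicCompletion ℚ)),
      IsHondaSystem κ (closureEmb (K := ℚ) (v.adicCompletion ℚ)) W (W.frobeniusTrace p) g cneg c →
    ∀ (col : Chroma)
      (D : SharpFlatSelmerDualData W κ γ (closureEmb (K := ℚ) (v.adicCompletion ℚ))
        (W.frobeniusTrace p) g c col) [Module.Finite (IwasawaAlgebra p) D.X],
      Module.IsTorsion (IwasawaAlgebra p) D.X →
    ∀ (f : IwasawaAlgebra p), D.charIdeal = Ideal.span {f} →
      Finite (W.selmerGroupPInfty p) →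
      ∃ u : ℤ_[p]ˣ,
        ((PowerSeries.constantCoeff f : ℤ_[p]) : ℚ_[p]) =
          ((u : ℤ_[p]) : ℚ_[p]) * (p : ℚ_[p]) ^ (padicValNat p W.tamagawaProduct) *
            (Nat.card (W.selmerGroupPInfty p) : ℚ_[p])

/-- EDGE (faithfulness record): the all-conductor form specialises to the printed §5.2 form with its
standing square-free hypothesis (`W.IsSemistable (𝓞 ℚ)` is simply not used).
[cite: Sprung2024, §5.2 Lemmas 5.5, 5.8, 5.9 (pp. 40–41)] [cite: RaySprung2025, p. 2343] -/
theorem lem59_sharpFlatCharValue_rankZero_of_allN (h : lem59AllN_sharpFlatCharValue_rankZero) :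
    lem59_sharpFlatCharValue_rankZero := by
  intro W _ _ p _ hp2 _ hgood hap hL κ γ hκ hγ hX v hv g hg cneg c hH col D _ htor f hf hfin
  exact h W p hp2 hgood hap hL κ γ hκ hγ hX v hv g hg cneg c hH col D htor f hf hfin

end Literature.NumberTheory.EllipticCurves.Sprung2024

end
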